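import Summits.AtomisticToContinuum.Crystallization.Theses.NashClassCertificates

/-!
# Sketch — crux-ideate `NashNearField` (stmt-AtomisticToContinuum-16827), round 1, ideator 2

First lemmas of the two idea cards (statements only; they must elaborate, not be proved):

* `NashForceBalance` — inside the proof the Nash best-response clause is used ONLY through
  per-particle force balance (shared first lemma; Fermat at an interior minimum of the hole
  potential, provable now, cf. the PROVED `ExcessDecayLiouville.ForceBalance` for ground states).
* `TubeCoercivity` — card `tube-coercive-dirichlet`: the frozen-exterior second variation of the
  Lennard-Jones energy on ANY all-good region of ANY 1/3-separated configuration is coercive in the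
  nearest-neighbour strain norm (kit j024265 part B: κ ≥ 3.1 on radius-3 fcc/hcp balls over the whole
  1/20 strain tube, 8.6 at the relaxed lattice).
* `nash_unique_of_tubeCoercivity` (shape only, abstract): two critical points of a strictly convex
  function on a convex set coincide — the form in which TubeCoercivity turns Nash regions into UNIQUE
  Dirichlet minimisers for their own exterior.
* `DepthLayerCake` — card `lattice-saint-venant-layercake`: sites of `Ω` within distance `d` of the
  radius-4 collar number at most `C(δ)(1+d)³ · #∂₄Ω` (ball packing); this is what converts
  finite-depth decay of lattice-scale equilibrium content into the crux's own `C·#∂₄Ω` term.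
-/

namespace Summit.AtomisticToContinuum.Crystallization.Cruxes.NashNearField.IdeatorTwo

open scoped BigOperators InnerProductSpace RealInnerProductSpace
open Literature.MathematicalPhysics.StatisticalMechanics Literature.Geometry.DiscreteGeometry

local notation "E3" => EuclideanSpace ℝ (Fin 3)

/-- The route's inline Nash (best-response) clause, verbatim. -/
def IsNash {N : ℕ} (x : Fin N → E3) : Prop :=
  ∀ (i : Fin N) (y : E3), (∀ j : Fin N, j ≠ i → y ≠ x j) →
    siteEnergy lennardJones x i ≤ ∑ j ∈ Finset.univ.erase i, lennardJones (dist y (x j))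

/-- `1/3`-separation, verbatim. -/
def Sep {N : ℕ} (x : Fin N → E3) : Prop := ∀ i j : Fin N, i ≠ j → (1 / 3 : ℝ) ≤ dist (x i) (x j)

/-- SHARED FIRST LEMMA (provable now): a separated Nash configuration is in per-particle force
balance, `Σ_{j ≠ i} V′(r_ij) (x_i − x_j)/r_ij = 0`.  Inside good regions this is ALL the Nash clause
gives (on-site Hessian and global best response are automatic / slack there). -/
def NashForceBalance : Prop :=
  ∀ (N : ℕ) (x : Fin N → E3), Sep x → IsNash x → ∀ i : Fin N,
    ∑ j ∈ Finset.univ.erase i,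
      (deriv lennardJones (dist (x i) (x j)) / dist (x i) (x j)) • (x i - x j) = (0 : E3)

/-- Second variation of `V(‖e + s w‖)` at `s = 0` (same expression as `PhononStability`'s `Hess`). -/
noncomputable def hessPair (e w : E3) : ℝ :=
  deriv (deriv lennardJones) ‖e‖ * (⟪e, w⟫ / ‖e‖) ^ 2 +
    deriv lennardJones ‖e‖ / ‖e‖ * (‖w‖ ^ 2 - (⟪e, w⟫ / ‖e‖) ^ 2)

/-- CARD `tube-coercive-dirichlet`, first lemma / crux-level claim `TubeCoercivity`: there is
`κ > 0` such that for every `1/3`-separated configuration `x`, every region `Ω'` all of whose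
radius-4 neighbourhoods are `1/20`-good, and every displacement `u` supported in `Ω'` (exterior
FROZEN), the second variation of the LJ energy dominates `κ ×` the nearest-neighbour strain norm.
No Nash hypothesis: it is a statement about the goodness tube.  With Nash (force balance in `Ω'`)
it makes `x|_{Ω'}` the UNIQUE critical point — hence the minimiser — of the energy in the tube for
its own exterior data. -/
def TubeCoercivity : Prop :=
  ∃ κ : ℝ, 0 < κ ∧ ∀ (N : ℕ) (x : Fin N → E3), Sep x →
    ∀ Ω' : Finset (Fin N),
      (∀ i ∈ Ω', ∀ j : Fin N, dist (x j) (x i) ≤ 4 → IsTwoShellGood (1 / 20) (47 / 50) 1 x j) →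
      ∀ u : Fin N → E3, (∀ i, i ∉ Ω' → u i = 0) →
        κ * (∑ i, ∑ j ∈ Finset.univ.erase i,
              (if dist (x i) (x j) ≤ 11 / 10 then ‖u i - u j‖ ^ 2 else 0)) ≤
          (1 / 2 : ℝ) * ∑ i, ∑ j ∈ Finset.univ.erase i, hessPair (x i - x j) (u i - u j)

/-- Shape of the uniqueness step (abstract, Mathlib vocabulary): a strictly convex function on a
convex set has at most one point where it attains a minimum — applied to the LJ energy of `Ω'`
with frozen exterior on the (convexified) goodness tube, whose critical points are minima by
`TubeCoercivity`. -/
theorem unique_min_of_strictConvexOn {E : Type*} [NormedAddCommGroup E] [InnerProductSpace ℝ E]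
    {K : Set E} {f : E → ℝ} (hf : StrictConvexOn ℝ K f) {x y : E} (hx : x ∈ K) (hy : y ∈ K)
    (hxmin : IsMinOn f K x) (hymin : IsMinOn f K y) : x = y := by
  by_contra hne
  have ha : (0 : ℝ) < 1 / 2 := by norm_num
  have hab : (1 / 2 : ℝ) + 1 / 2 = 1 := by norm_num
  have h : f ((1 / 2 : ℝ) • x + (1 / 2 : ℝ) • y) < (1 / 2 : ℝ) • f x + (1 / 2 : ℝ) • f y :=
    hf.2 hx hy hne ha ha hab
  have hm : (1 / 2 : ℝ) • x + (1 / 2 : ℝ) • y ∈ K := hf.1 hx hy ha.le ha.le hab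
  have h1 : f x ≤ f ((1 / 2 : ℝ) • x + (1 / 2 : ℝ) • y) := hxmin hm
  have h2 : f y ≤ f ((1 / 2 : ℝ) • x + (1 / 2 : ℝ) • y) := hymin hm
  simp only [smul_eq_mul] at h
  linarith

/-- CARD `lattice-saint-venant-layercake`, first lemma `DepthLayerCake` (pure geometry, M-sized):
in a `δ`-separated configuration, the particles of `Ω` lying within distance `d` of a collar
particle (a particle of `Ω` with a non-`Ω` particle within `4`) number at most
`C(δ) · (1 + d)³ ·` (number of collar particles). -/
def DepthLayerCake : Prop :=
  ∀ δ : ℝ, 0 < δ → ∃ C : ℝ, ∀ (N : ℕ) (x : Fin N → E3),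
    (∀ i j : Fin N, i ≠ j → δ ≤ dist (x i) (x j)) →
    ∀ (Ω : Finset (Fin N)) (d : ℝ), 0 ≤ d →
      (Nat.card {i : Fin N // i ∈ Ω ∧ ∃ j : Fin N, (j ∈ Ω ∧ ∃ k : Fin N, k ∉ Ω ∧ dist (x k) (x j) ≤ 4) ∧
          dist (x j) (x i) ≤ d} : ℝ) ≤
        C * (1 + d) ^ 3 * (Nat.card {j : Fin N // j ∈ Ω ∧ ∃ k : Fin N, k ∉ Ω ∧ dist (x k) (x j) ≤ 4} : ℝ)

/-- Read-back: the crux's Nash clause is this file's `IsNash` and its separation is `Sep`. -/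
example {N : ℕ} (x : Fin N → E3) :
    (Sep x ∧ IsNash x) ↔
      ((∀ i j : Fin N, i ≠ j → (1 / 3 : ℝ) ≤ dist (x i) (x j)) ∧
        ∀ (i : Fin N) (y : E3), (∀ j : Fin N, j ≠ i → y ≠ x j) →
          siteEnergy lennardJones x i ≤ ∑ j ∈ Finset.univ.erase i, lennardJones (dist y (x j))) :=
  Iff.rfl

end Summit.AtomisticToContinuum.Crystallization.Cruxes.NashNearField.IdeatorTwo
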